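import Mathlib
import HarnessLib
import Summits.NavierStokesRegularity.NavierStokesRegularity.Theorems.ChiralWindowDoorTimeIntegratedError

/-!
# Door S21-C «CriticalFluxDoor» — the scale-invariant TIME KERNELS of the commutator pairing (F3-DERIVATION §2 (c))

Door S21-C of nsreg-p1's local Type-I door family (`HOME/ns-regularity-ideate-p1/ROUND-20.md` §2b F3; DESIGN-ONLY,
route NOT born).  The near-zone and far-zone parts of the commutator pairing `∫⟪[Λ,a_R]v, ∂ₜv⟫` of the windowed
critical-energy budget are bounded, at time `t = −s < 0`, by two-regime kernels
`k_α(s) = R^{2α−2} s^{−α}` for `s ≤ R²` and `R² s^{−2}` for `s ≥ R²` (`α = 3/4` near the apex, where `∂ₜv ~ ‖x‖⁻³`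
meets the `O(s^{−1/2}/R)` size of the commutator; `α = 1/2` in the far field), whose time integrals are independent of
the scale `R`: `∫₀^∞ k_α = 1/(1−α) + 1`.

* `twoRegimeKernel_nonneg`, `integral_nearBranch`, `integral_farBranch`, `integral_twoRegimeKernel_le` — for `α < 1`, `R > 0`:
  `t ↦ k_α(−t)` is integrable on `(−∞, 0)` with integral `≤ 1/(1−α) + 1`.

Seat nsreg-p6 g13 (THEOREMS-ONLY door sequels, DIRECTOR-NS g8 #32 (2)/#36).  WHAT THIS IS NOT: not NS regularity (Clay A);
one-dimensional calculus; no route is opened.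
-/

noncomputable section

-- the summit and its single sub-problem share the name (CONVENTIONS §1), as in every Theorems file
set_option linter.dupNamespace false

namespace Summit.NavierStokesRegularity.NavierStokesRegularity.Theorems.CriticalFluxDoorTimeKernels

open MeasureTheory Set Filter Topology
open Summit.NavierStokesRegularity.NavierStokesRegularity.Theorems.ChiralWindowDoorTimeIntegratedError
  (integrableOn_Iio_comp_neg)

/-- The two-regime kernel is non-negative. -/
theorem twoRegimeKernel_nonneg (α R s : ℝ) (hR : 0 < R) (hs : 0 ≤ s) :
    0 ≤ (if s ≤ R ^ 2 then R ^ (2 * α - 2) * s ^ (-α) else R ^ 2 * s ^ (-(2 : ℝ))) := by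
  split_ifs
  · exact mul_nonneg (Real.rpow_nonneg hR.le _) (Real.rpow_nonneg hs _)
  · exact mul_nonneg (sq_nonneg R) (Real.rpow_nonneg hs _)

/-- The near-apex branch `s ↦ R^{2α−2} s^{−α}` is integrable on `(0, R²]` with integral `1/(1−α)` (`α < 1`). -/
theorem integral_nearBranch {α R : ℝ} (hα : α < 1) (hR : 0 < R) :
    IntegrableOn (fun s : ℝ => R ^ (2 * α - 2) * s ^ (-α)) (Ioc 0 (R ^ 2)) ∧
      ∫ s in Ioc 0 (R ^ 2), R ^ (2 * α - 2) * s ^ (-α) = 1 / (1 - α) := by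
  have hR2 : 0 < R ^ 2 := by positivity
  have hint : IntervalIntegrable (fun s : ℝ => s ^ (-α)) volume 0 (R ^ 2) :=
    intervalIntegral.intervalIntegrable_rpow' (by linarith)
  have hi : IntegrableOn (fun s : ℝ => s ^ (-α)) (Ioc 0 (R ^ 2)) := (intervalIntegrable_iff_integrableOn_Ioc_of_le hR2.le).1 hint
  refine ⟨hi.const_mul _, ?_⟩
  rw [MeasureTheory.integral_const_mul, ← intervalIntegral.integral_of_le hR2.le, integral_rpow (Or.inl (by linarith))]
  have h1 : -α + 1 ≠ 0 := by linarith
  rw [Real.zero_rpow h1, sub_zero, ← Real.rpow_natCast, ← Real.rpow_mul hR.le]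
  rw [show ((2 : ℕ) : ℝ) * (-α + 1) = -(2 * α - 2) by push_cast; ring, Real.rpow_neg hR.le, div_eq_mul_inv,
    ← mul_assoc, mul_inv_cancel₀ (Real.rpow_pos_of_pos hR _).ne', one_mul, show -α + 1 = 1 - α by ring, one_div]

/-- The far branch `s ↦ R² s^{−2}` is integrable on `(R², ∞)` with integral `1`. -/
theorem integral_farBranch {R : ℝ} (hR : 0 < R) :
    IntegrableOn (fun s : ℝ => R ^ 2 * s ^ (-(2 : ℝ))) (Ioi (R ^ 2)) ∧
      ∫ s in Ioi (R ^ 2), R ^ 2 * s ^ (-(2 : ℝ)) = 1 := by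
  have hR2 : 0 < R ^ 2 := by positivity
  refine ⟨(integrableOn_Ioi_rpow_of_lt (by norm_num) hR2).const_mul _, ?_⟩
  rw [MeasureTheory.integral_const_mul, integral_Ioi_rpow_of_lt (by norm_num) hR2]
  rw [show (-(2 : ℝ)) + 1 = -1 by norm_num, Real.rpow_neg_one]
  field_simp

/-- **The two-regime kernel is integrable on `(−∞,0)` (as a function of `t = −s`) with integral `≤ 1/(1−α) + 1`**,
for `α < 1` and `R > 0` — independent of `R`. -/
theorem integral_twoRegimeKernel_le {α R : ℝ} (hα : α < 1) (hR : 0 < R) :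
    IntegrableOn (fun t : ℝ =>
        if -t ≤ R ^ 2 then R ^ (2 * α - 2) * (-t) ^ (-α) else R ^ 2 * (-t) ^ (-(2 : ℝ))) (Iio 0) ∧
      ∫ t in Iio (0 : ℝ), (if -t ≤ R ^ 2 then R ^ (2 * α - 2) * (-t) ^ (-α) else R ^ 2 * (-t) ^ (-(2 : ℝ))) ≤
        1 / (1 - α) + 1 := by
  have hR2 : 0 < R ^ 2 := by positivity
  set K : ℝ → ℝ := fun s => if s ≤ R ^ 2 then R ^ (2 * α - 2) * s ^ (-α) else R ^ 2 * s ^ (-(2 : ℝ)) with hK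
  obtain ⟨hn, hnval⟩ := integral_nearBranch hα hR
  obtain ⟨hf, hfval⟩ := integral_farBranch hR
  -- `K` on `(0, ∞) = (0, R²] ∪ (R², ∞)`
  have hK1 : IntegrableOn K (Ioc 0 (R ^ 2)) :=
    hn.congr_fun (fun s hs => by rw [hK]; dsimp only; rw [if_pos hs.2]) measurableSet_Ioc
  have hK2 : IntegrableOn K (Ioi (R ^ 2)) :=
    hf.congr_fun (fun s hs => by rw [hK]; dsimp only; rw [if_neg (not_le.2 hs)]) measurableSet_Ioi
  have hunion : Ioc 0 (R ^ 2) ∪ Ioi (R ^ 2) = Ioi (0 : ℝ) := Ioc_union_Ioi_eq_Ioi hR2.le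
  have hKi : IntegrableOn K (Ioi 0) := by rw [← hunion]; exact hK1.union hK2
  have hKval : ∫ s in Ioi (0 : ℝ), K s = 1 / (1 - α) + 1 := by
    have hdisj : Disjoint (Ioc 0 (R ^ 2)) (Ioi (R ^ 2)) := Set.disjoint_left.2 fun s hs hs' => (not_lt.2 hs.2) hs'
    rw [← hunion, setIntegral_union hdisj measurableSet_Ioi hK1 hK2]
    have e1 : ∫ s in Ioc 0 (R ^ 2), K s = ∫ s in Ioc 0 (R ^ 2), R ^ (2 * α - 2) * s ^ (-α) :=
      setIntegral_congr_fun measurableSet_Ioc (fun s hs => by rw [hK]; dsimp only; rw [if_pos hs.2])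
    have e2 : ∫ s in Ioi (R ^ 2), K s = ∫ s in Ioi (R ^ 2), R ^ 2 * s ^ (-(2 : ℝ)) :=
      setIntegral_congr_fun measurableSet_Ioi (fun s hs => by rw [hK]; dsimp only; rw [if_neg (not_le.2 hs)])
    rw [e1, e2, hnval, hfval]
  -- transport to `t = −s`
  have hKi' : IntegrableOn (fun t => K (-t)) (Iio 0) := integrableOn_Iio_comp_neg (c := 0) (by rw [neg_zero]; exact hKi)
  refine ⟨hKi'.congr_fun (fun t _ => by rw [hK]) measurableSet_Iio, ?_⟩
  have heq : ∫ t in Iio (0 : ℝ), (if -t ≤ R ^ 2 then R ^ (2 * α - 2) * (-t) ^ (-α) else R ^ 2 * (-t) ^ (-(2 : ℝ))) =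
      ∫ t in Iio (0 : ℝ), K (-t) := setIntegral_congr_fun measurableSet_Iio fun t _ => by rw [hK]
  rw [heq, ← integral_Iic_eq_integral_Iio, integral_comp_neg_Iic 0 K, neg_zero, hKval]

end Summit.NavierStokesRegularity.NavierStokesRegularity.Theorems.CriticalFluxDoorTimeKernels

end
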